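import Literature.NumberTheory.GaloisCohomology.Howard2004.TauEigencocycleNonvanishingProofs
import Literature.NumberTheory.GaloisCohomology.Howard2004.ChebotarevInertPrimesProofs
import Literature.NumberTheory.GaloisRepresentations.ContinuousH1OpenKernelProofs
import Literature.NumberTheory.GaloisRepresentations.GaloisCohomologyScalarAction
import HarnessLib

/-!
# Howard 2004, Lemma 1.6.2 — junction of the `τ`-eigenspace step with the Čebotarev step: an inert
# prime whose Frobenius `x = (uσ)^τ(uσ)` has `φ^±(x) ≠ 0`; entries from classes; a standard `Λ`

Topic `NumberTheory/GaloisCohomology/Howard2004` (input of Howard's Lemma 1.6.4, the residual Galois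
input of the print leaf G87 `Howard2004.thm161_dvrKolyvaginBound` = Thm. 1.6.1; cell
`pub/bsd-print-x9`, seat `bsd-line-x10b-p1-w2` g15).  THEOREMS ONLY: no definition, no named fact,
no instance, no notation, no `sorry`.  Companion of `TauEigencocycleNonvanishingProofs.lean` (the
eigenspace step: `∃ σ ∈ Λ`, open `U ≤ Λ`, `φ^±((uσ)^τ(uσ)) ≠ 0`) and of
`ChebotarevInertPrimesProofs.lean` (seat w6 g8: inert primes with Frobenius `(ug)^τ(ug)`, `u ∈ U`).

Printed source.  B. Howard, *The Heegner point Kolyvagin system*, Compositio Math. **140** (2004)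
= arXiv:1202.6340, Lemma 1.6.2 (arXiv Lemma 2.6.2, p. 11 L30–58), proof p. 11 L45–50: «… there is
an `η ∈ G⁺` for which `c^±(η)` are both nonzero, and we may choose some `σ ∈ G` such that
`η = (τσ)²`.  By the Cebotarev theorem, there are infinitely many primes `ℓ` of `ℚ` whose Frobenius
class in `Gal(E/ℚ)` is equal to `τσ`, and at which the localizations of `c^±` are unramified.  For
such an `ℓ`, the image of `c^±` under `H¹(K,T̄) → H¹(K_ℓ,T̄) → H¹_unr(K_ℓ,T̄) ≅ T̄` (the final
isomorphism being evaluation at the Frobenius of the prime of `K` above `ℓ`) is equal to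
`c^±(η) ≠ 0`.»

* §4 **`ResidualTau.exists_inert_prime_isArithFrobAt_apply_ne_zero`** — COROLLARY of the eigenspace
  step with the landed Čebotarev step `exists_inert_prime_isArithFrobAt_conjGal_mul` BY NAME:
  outside any finite sets `B` (rational primes) and `S` (places of `K`) there is an inert prime `ℓ`
  of the imaginary quadratic field `K`, with a Frobenius `x = g^τ g ∈ Λ` (`g ∈ Λ`) at a prime of
  `\bar ℤ_K` above its place, such that `φ⁺(x) ≠ 0` and `φ⁻(x) ≠ 0`, together with the
  root-of-unity clauses («`m ∣ ℓ + 1`» when `g` fixes `μₘ`) verbatim; single-cocycle version.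
  = Lemma 1.6.2 up to the local criterion «`loc_λ [φ] = 0 ⟺ φ(Frob_λ) = 0`» (seat w6 g8, in
  flight) and the choice of `Λ` (§6).
* §5 entries from classes: `exists_mem_apply_ne_zero_of_resSubgroup_injOn` (`[φ] ≠ 0` and
  restriction to some `Λ₀ ≤ Λ` injective — H.2's clause for `Λ₀ = Γ_F ⊓ ⨅ₘ ker μ_{p^m}` — ⇒
  `φ|_Λ ≠ 0`), `ResidualTau.exists_conjTwist_cocycle` (the cocycle `g ↦ θ(φ(g^τ))`, i.e. the
  action of `τ` on `Z¹(K, T̄)`), and **`ResidualTau.exists_eigencocycle_decomposition`**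
  (`2 ∈ R×`: every cocycle is `φ⁺ + φ⁻` with `φ^±(g^τ) = ±θ(φ^±(g))` POINTWISE on `Γ_K`, so a class
  non-zero on `Λ` has an eigencomponent non-zero on `Λ`).
* §6 **`ConjugationDatum.exists_standard_open_subgroup`** — for a finite module `M` (a level
  `T^{(j)}`) and `n ≥ 1` (`p^{2k-1}`), `Λ = ker M ⊓ (ker M)^τ ⊓ ker μₙ` is open, normal, `τ`-stable,
  acts trivially on `M`, fixes `μₙ`, and contains `Γ₀ ⊓ Γ₁` for `Γ₀` `τ`-stable acting trivially and
  `Γ₁ ≤ ker μₙ` (H.2's `Γ_F ⊓ ⨅ₘ ker μ_{p^m}`, by `iInf_ker_mu_le_ker_mu_pow` and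
  `ConjugationDatum.conj_mem_iInf_ker_mu`); `mem_ker_mu_iff`.

* §7 (append) values at `σ^τ σ` (`σ ∈ Λ`) of `(±)`-eigencocycles are `(±)`-eigenvectors of `θ`
  (`theta_apply_conj_mul_self_of_theta_eq[_neg]`), so eigencomponents do not cancel there
  (`apply_add_apply_conj_mul_self_ne_zero`); **`exists_inert_prime_isArithFrobAt_three_apply_ne_zero`**
  (and `…'`): ONE Frobenius `x = g^τ g` with `d(x) ≠ 0`, `d^±(x) ≠ 0`, `c^∓(x) ≠ 0` — the three
  classes of Lemma 1.6.4, Case i.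

HONEST FRAMING.  Lemma 1.6.2's local criterion, Lemma 1.6.4 and Thm. 1.6.1 are NOT here;
`thm161_dvrKolyvaginBound` is NOT proved; no summit statement is proved; the Birch–Swinnerton-Dyer
conjecture is not proved by any of this.  Input named fact (§4 only): the Čebotarev density theorem
`Automorphic.chebotarev_artinRep` (a hypothesis; PROVED in the tree as
`Automorphic.chebotarev_artinRep_holds`).

References: [Howard2004HeegnerKolyvagin] Lemma 1.6.2 (arXiv 2.6.2, p. 11 L30–58) and §1.3 H.2,
H.5(a) (arXiv p. 7); [McCallumLMS1991] §3 Prop. 3.1 (proof); [SerreGaloisCohomology1997] I §2,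
II §1.2.
-/

set_option autoImplicit false

noncomputable section

open scoped Classical Pointwise
open Function NumberField IsDedekindDomain Field

namespace Literature.NumberTheory.GaloisCohomology.Howard2004

open Literature.NumberTheory.GaloisRepresentations
open Literature.NumberTheory.EllipticCurves

variable {K : Type} [Field K] [NumberField K] {Nbar : Type} [AddCommGroup Nbar]
  [TopologicalSpace Nbar] [DiscreteTopology Nbar]

namespace ResidualTau

variable {R : Type} [CommRing R] [Module R Nbar] {cd : ConjugationDatum K}
  {ρbar : DiscreteGaloisModule K Nbar}

/-! ## §4 With the Čebotarev step: an inert prime whose Frobenius `x = (uσ)^τ(uσ)` has `φ^±(x) ≠ 0` -/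

/-- **Lemma 1.6.2 up to the local criterion, both classes.**  `K` imaginary quadratic, `cd` its
conjugation datum (`τ` an involutive lift of `σ ≠ 1`), Čebotarev (`Automorphic.chebotarev_artinRep`,
proved in the tree).  Under the hypotheses of `exists_isOpen_forall_apply_conj_mul_ne_zero`, for
every finite set `B` of rational primes and finite set `S` of places of `K` there are a prime
`ℓ ∉ B` INERT in `K` with place `w ∉ S`, and an element `x = g^τ g ∈ Λ` (`g ∈ Λ`) which is an
arithmetic Frobenius at a prime of `\bar ℤ_K` above `w` and at which `φ⁺(x) ≠ 0` and `φ⁻(x) ≠ 0`;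
moreover `τ(g ζ) = ζ^ℓ` on roots of unity of order prime to `ℓ`, so `m ∣ ℓ + 1` whenever `g` fixes
`μ_m` («`ℓ ∈ 𝓛_{2k-1}`» once `Λ` fixes `μ_{p^{2k-1}}`).  «By the Cebotarev theorem, there are
infinitely many primes `ℓ` of `ℚ` whose Frobenius class in `Gal(E/ℚ)` is equal to `τσ` … the image of
`c^±` … (evaluation at the Frobenius of the prime of `K` above `ℓ`) is equal to `c^±(η) ≠ 0`.»
[cite: Howard2004HeegnerKolyvagin, Lemma 1.6.2 (arXiv 2.6.2, p. 11 L30–58)] -/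
theorem exists_inert_prime_isArithFrobAt_apply_ne_zero (hC : Automorphic.chebotarev_artinRep)
    (hK : IsImaginaryQuadratic K) (A : ResidualTau (R := R) cd ρbar)
    (hlin : ρbar.IsScalarLinear R)
    (hirr : ∀ W : Submodule R Nbar,
      (∀ (σ : absoluteGaloisGroup K) (x : Nbar), x ∈ W → ρbar σ x ∈ W) → W = ⊥ ∨ W = ⊤)
    (h5a : H5a A) (htwo : IsUnit (2 : R))
    {Λ : Subgroup (absoluteGaloisGroup K)} (hΛo : IsOpen (Λ : Set (absoluteGaloisGroup K)))
    (hΛn : Λ.Normal) (hΛc : ∀ g ∈ Λ, cd.conj g ∈ Λ) (hΛt : ∀ g ∈ Λ, ∀ x : Nbar, ρbar g x = x)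
    (φp φm : contOneCocycles ρbar.toTopRep)
    (hφp : ∀ g ∈ Λ, φp.1 (cd.conj g) = A.θ (φp.1 g))
    (hφm : ∀ g ∈ Λ, φm.1 (cd.conj g) = -A.θ (φm.1 g))
    (hnep : ∃ g ∈ Λ, φp.1 g ≠ 0) (hnem : ∃ g ∈ Λ, φm.1 g ≠ 0)
    (B : Finset ℕ) {S : Set (HeightOneSpectrum (𝓞 K))} (hS : S.Finite) :
    ∃ ℓ : ℕ, ℓ.Prime ∧ ℓ ∉ B ∧ (Ideal.span {(ℓ : 𝓞 K)}).IsPrime ∧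
      ∃ w : HeightOneSpectrum (𝓞 K), w ∉ S ∧ (ℓ : 𝓞 K) ∈ w.asIdeal ∧
        (∀ w' : HeightOneSpectrum (𝓞 K), (ℓ : 𝓞 K) ∈ w'.asIdeal → w' = w) ∧
        ∃ g ∈ Λ, cd.conj g * g ∈ Λ ∧
          (∃ 𝔔 ∈ w.primesAbove, IsArithFrobAt (𝓞 K) (cd.conj g * g) 𝔔) ∧
          φp.1 (cd.conj g * g) ≠ 0 ∧ φm.1 (cd.conj g * g) ≠ 0 ∧
          (∀ (m : ℕ) (ζ : AlgebraicClosure K), ¬ ℓ ∣ m → ζ ^ m = 1 → cd.τ (g • ζ) = ζ ^ ℓ) ∧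
          ∀ m : ℕ, ¬ ℓ ∣ m → (∀ ζ : AlgebraicClosure K, ζ ^ m = 1 → g • ζ = ζ) → m ∣ ℓ + 1 := by
  obtain ⟨σ, hσ, U, hUo, hUΛ, hU⟩ := exists_isOpen_forall_apply_conj_mul_ne_zero A hlin hirr h5a
    htwo hΛo hΛn hΛc hΛt φp φm hφp hφm hnep hnem
  obtain ⟨ℓ, hℓ, hℓB, hℓP, w, hwS, hℓw, hwu, u, hu, hfrob, hζ, hdiv⟩ :=
    exists_inert_prime_isArithFrobAt_conjGal_mul hC hK cd.σ_ne_one cd.isLift cd.involutive hUo σ B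
      hS
  have hug : u * σ ∈ Λ := Λ.mul_mem (hUΛ hu) hσ
  exact ⟨ℓ, hℓ, hℓB, hℓP, w, hwS, hℓw, hwu, u * σ, hug, Λ.mul_mem (hΛc _ hug) hug, hfrob,
    (hU u hu).1, (hU u hu).2, hζ, hdiv⟩

/-- **Lemma 1.6.2 up to the local criterion, one class** (generic sign `L`, fixed vector `v`; for
Case ii of Lemma 1.6.4, where only one eigenclass is given).
[cite: Howard2004HeegnerKolyvagin, Lemma 1.6.2 (arXiv 2.6.2, p. 11 L30–58: «We consider only the case where `c⁺`, `c⁻` are both nonzero, the other case being entirely similar»)] -/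
theorem exists_inert_prime_isArithFrobAt_apply_ne_zero_single (hC : Automorphic.chebotarev_artinRep)
    (hK : IsImaginaryQuadratic K) (cd : ConjugationDatum K) (ρbar : DiscreteGaloisModule K Nbar)
    (hlin : ρbar.IsScalarLinear R)
    (hirr : ∀ W : Submodule R Nbar,
      (∀ (σ : absoluteGaloisGroup K) (x : Nbar), x ∈ W → ρbar σ x ∈ W) → W = ⊥ ∨ W = ⊤)
    (htwo : IsUnit (2 : R)) (L : Nbar →ₗ[R] Nbar) {v : Nbar} (hv : v ≠ 0) (hLv : L v = v)
    {Λ : Subgroup (absoluteGaloisGroup K)} (hΛo : IsOpen (Λ : Set (absoluteGaloisGroup K)))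
    (hΛn : Λ.Normal) (hΛc : ∀ g ∈ Λ, cd.conj g ∈ Λ) (hΛt : ∀ g ∈ Λ, ∀ x : Nbar, ρbar g x = x)
    (φ : contOneCocycles ρbar.toTopRep) (hφ : ∀ g ∈ Λ, φ.1 (cd.conj g) = L (φ.1 g))
    (hne : ∃ g ∈ Λ, φ.1 g ≠ 0)
    (B : Finset ℕ) {S : Set (HeightOneSpectrum (𝓞 K))} (hS : S.Finite) :
    ∃ ℓ : ℕ, ℓ.Prime ∧ ℓ ∉ B ∧ (Ideal.span {(ℓ : 𝓞 K)}).IsPrime ∧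
      ∃ w : HeightOneSpectrum (𝓞 K), w ∉ S ∧ (ℓ : 𝓞 K) ∈ w.asIdeal ∧
        (∀ w' : HeightOneSpectrum (𝓞 K), (ℓ : 𝓞 K) ∈ w'.asIdeal → w' = w) ∧
        ∃ g ∈ Λ, cd.conj g * g ∈ Λ ∧
          (∃ 𝔔 ∈ w.primesAbove, IsArithFrobAt (𝓞 K) (cd.conj g * g) 𝔔) ∧
          φ.1 (cd.conj g * g) ≠ 0 ∧
          (∀ (m : ℕ) (ζ : AlgebraicClosure K), ¬ ℓ ∣ m → ζ ^ m = 1 → cd.τ (g • ζ) = ζ ^ ℓ) ∧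
          ∀ m : ℕ, ¬ ℓ ∣ m → (∀ ζ : AlgebraicClosure K, ζ ^ m = 1 → g • ζ = ζ) → m ∣ ℓ + 1 := by
  obtain ⟨σ, hσ, U, hUo, hUΛ, hU⟩ := exists_isOpen_forall_apply_conj_mul_ne_zero_single cd ρbar
    hlin hirr htwo L hv hLv hΛo hΛn hΛc hΛt φ hφ hne
  obtain ⟨ℓ, hℓ, hℓB, hℓP, w, hwS, hℓw, hwu, u, hu, hfrob, hζ, hdiv⟩ :=
    exists_inert_prime_isArithFrobAt_conjGal_mul hC hK cd.σ_ne_one cd.isLift cd.involutive hUo σ B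
      hS
  have hug : u * σ ∈ Λ := Λ.mul_mem (hUΛ hu) hσ
  exact ⟨ℓ, hℓ, hℓB, hℓP, w, hwS, hℓw, hwu, u * σ, hug, Λ.mul_mem (hΛc _ hug) hug, hfrob,
    hU u hu, hζ, hdiv⟩

end ResidualTau

/-! ## §5 Entries from classes: non-vanishing on `Λ`, the action of `τ` on cocycles, eigen-splitting -/

section Classes

variable (ρbar : DiscreteGaloisModule K Nbar)

omit [NumberField K] in
/-- **«restriction is an injection» ⇒ `φ|_Λ ≠ 0`**: if the restriction `H¹(Γ_K, T̄) → H¹(Λ₀, T̄)` kills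
no non-zero class (the H.2 clause supplies this for `Λ₀ = Γ_{F(μ_{p^∞})}`), `Λ₀ ≤ Λ`, `Λ` acts
trivially on `T̄`, and `[φ] ≠ 0`, then `φ(g) ≠ 0` for some `g ∈ Λ` (a cocycle vanishing on a
subgroup acting trivially is principal there).
[cite: Howard2004HeegnerKolyvagin, Lemma 1.6.2 proof (arXiv p. 11 L36–40: «restriction `H¹(K,T̄) → H¹(L,T̄)^{Gal(L/K)} ≅ Hom(G_L,T̄)^{Gal(L/K)}` is an injection»)] -/
theorem exists_mem_apply_ne_zero_of_resSubgroup_injOn {Λ₀ Λ : Subgroup (absoluteGaloisGroup K)}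
    (hle : Λ₀ ≤ Λ)
    (hinj : ∀ c : galoisCohomology ρbar 1, (resSubgroup ρbar.toTopRep Λ₀ 1).hom c = 0 → c = 0)
    (φ : contOneCocycles ρbar.toTopRep) (hc : oneCocycleClass ρbar.toTopRep φ ≠ 0) :
    ∃ g ∈ Λ, φ.1 g ≠ 0 := by
  by_contra hcon
  push Not at hcon
  refine hc (hinj _ ?_)
  change resSubgroup ρbar.toTopRep Λ₀ 1 (oneCocycleClass ρbar.toTopRep φ) = 0
  rw [resSubgroup_oneCocycleClass_eq_zero_iff]
  exact ⟨0, fun h hh => by rw [map_zero, sub_zero]; exact hcon h (hle hh)⟩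

variable {R : Type} [CommRing R] [Module R Nbar] {cd : ConjugationDatum K}
  {ρbar}

/-- **The action of `τ` on continuous cocycles**: for a cocycle `φ` of `T̄`, `g ↦ θ(φ(g^τ))` is again
a continuous cocycle of `T̄` (`θ ∘ ρ̄(g^τ) = ρ̄(g) ∘ θ`, H.5(a)); its class is `τ · [φ]` for the
`G_ℚ = G_K ⋊ ⟨τ⟩`-structure on `H¹(K, T̄)`.
[cite: Howard2004HeegnerKolyvagin, §1.3 H.5(a) and §1.5 preamble (arXiv p. 7 L93–95; p. 9 L122–126: «If `M` is any `R/𝔪`-vector space on which `τ` acts we denote by `M⁺` and `M⁻` …»)] -/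
theorem ResidualTau.exists_conjTwist_cocycle (A : ResidualTau (R := R) cd ρbar)
    (φ : contOneCocycles ρbar.toTopRep) :
    ∃ ψ : contOneCocycles ρbar.toTopRep, ∀ g, ψ.1 g = A.θ (φ.1 (cd.conj g)) := by
  refine ⟨⟨(⟨A.θ, continuous_of_discreteTopology⟩ : C(Nbar, Nbar)).comp
    (φ.1.comp (cd.conj : C(absoluteGaloisGroup K, absoluteGaloisGroup K))), fun g h => ?_⟩,
    fun g => rfl⟩
  change A.θ (φ.1 (cd.conj (g * h))) =
    A.θ (φ.1 (cd.conj g)) + ρbar.toTopRep.ρ g (A.θ (φ.1 (cd.conj h)))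
  rw [map_mul, (mem_contOneCocycles_iff φ.1).mp φ.2, map_add, ContinuousRep.toTopRep_ρ_apply,
    ContinuousRep.toTopRep_ρ_apply, A.compat]

/-- **Eigen-splitting of cocycles** (`2 ∈ R×`, `T̄` an `R`-linear module): every continuous cocycle
`φ` of `T̄` is POINTWISE `φ = φ⁺ + φ⁻` with continuous cocycles `φ^±` satisfying
`φ⁺(g^τ) = θ(φ⁺ g)` and `φ⁻(g^τ) = -θ(φ⁻ g)` for all `g ∈ Γ_K` — `φ^± = ½(φ ± τφ)`; so `[φ] =
[φ]⁺ + [φ]⁻` in `H¹(K, T̄) = H¹(K,T̄)⁺ ⊕ H¹(K,T̄)⁻`, and if `φ|_Λ ≠ 0` then `φ⁺|_Λ ≠ 0` or `φ⁻|_Λ ≠ 0`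
(«this `d` has nontrivial projection onto one of the `τ`-eigencomponents»).
[cite: Howard2004HeegnerKolyvagin, §1.5 preamble and Lemma 1.6.4 proof Case i (arXiv p. 9 L122–126; p. 12 L3–5)] -/
theorem ResidualTau.exists_eigencocycle_decomposition (A : ResidualTau (R := R) cd ρbar)
    (hlin : ρbar.IsScalarLinear R) (htwo : IsUnit (2 : R)) (φ : contOneCocycles ρbar.toTopRep) :
    ∃ φp φm : contOneCocycles ρbar.toTopRep, (∀ g, φ.1 g = φp.1 g + φm.1 g) ∧
      (∀ g, φp.1 (cd.conj g) = A.θ (φp.1 g)) ∧ (∀ g, φm.1 (cd.conj g) = -A.θ (φm.1 g)) := by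
  obtain ⟨ψ, hψ⟩ := A.exists_conjTwist_cocycle φ
  obtain ⟨u, hu⟩ := htwo
  have hcc : ∀ g, cd.conj (cd.conj g) = g := fun g =>
    cd.isLift.conjGalCMH_conjGalCMH cd.involutive g
  refine ⟨galoisCohomology.scalarCocycle ρbar hlin (u⁻¹ : Rˣ) (φ + ψ),
    galoisCohomology.scalarCocycle ρbar hlin (u⁻¹ : Rˣ) (φ - ψ), fun g => ?_, fun g => ?_,
    fun g => ?_⟩
  · rw [galoisCohomology.scalarCocycle_apply, galoisCohomology.scalarCocycle_apply, ← smul_add]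
    change φ.1 g = ((u⁻¹ : Rˣ) : R) • ((φ.1 g + ψ.1 g) + (φ.1 g - ψ.1 g))
    rw [add_add_sub_cancel, ← two_smul R, smul_smul, ← hu, Units.inv_mul, one_smul]
  · rw [galoisCohomology.scalarCocycle_apply, galoisCohomology.scalarCocycle_apply, map_smul]
    change ((u⁻¹ : Rˣ) : R) • (φ.1 (cd.conj g) + ψ.1 (cd.conj g)) =
      ((u⁻¹ : Rˣ) : R) • A.θ (φ.1 g + ψ.1 g)
    rw [hψ, hψ, hcc, map_add, A.involutive, add_comm]
  · rw [galoisCohomology.scalarCocycle_apply, galoisCohomology.scalarCocycle_apply, map_smul,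
      ← smul_neg]
    change ((u⁻¹ : Rˣ) : R) • (φ.1 (cd.conj g) - ψ.1 (cd.conj g)) =
      ((u⁻¹ : Rˣ) : R) • -A.θ (φ.1 g - ψ.1 g)
    rw [hψ, hψ, hcc, map_sub, A.involutive, neg_sub]

end Classes

/-! ## §6 A standard `Λ`: open, normal, `τ`-stable, acting trivially, fixing `μₙ`, above `Γ_{F(μ_{p^∞})}` -/

section Lambda

variable {M : Type} [AddCommGroup M] [TopologicalSpace M] [DiscreteTopology M]

omit [NumberField K] in
/-- The kernel of the action on a FINITE discrete module is open (a finite intersection of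
stabilisers). [cite: SerreGaloisCohomology1997, Ch. I §2.1 (discrete modules: stabilisers are open)] -/
theorem DiscreteGaloisModule.isOpen_ker_of_finite [Finite M] (ρ : DiscreteGaloisModule K M) :
    IsOpen (ρ.ker : Set (absoluteGaloisGroup K)) := by
  have h : (ρ.ker : Set (absoluteGaloisGroup K)) = ⋂ v : M, {g | ρ g v = v} := by
    ext g; simp [LinearMap.ext_iff, Set.mem_iInter]
  rw [h]
  exact isOpen_iInter_of_finite fun v => ContinuousRep.isOpen_setOf_apply_eq ρ v

omit [NumberField K] in
/-- Membership in the kernel of `μₙ`: `g` fixes every `n`-th root of unity of `K̄` (unfolding of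
`DiscreteGaloisModule.mu`; the two directions are the tree's
`ExplicitMuCocycles.smul_eq_self_of_mu_apply_eq_self` / `…mu_apply_eq_self_of_forall_smul_eq_self`,
re-proved here to keep the import light). [cite: SerreGaloisCohomology1997, Ch. II §1.2] -/
theorem mem_ker_mu_iff {n : ℕ} [NeZero n] (g : absoluteGaloisGroup K) :
    g ∈ (DiscreteGaloisModule.mu K n).ker ↔ ∀ ζ : AlgebraicClosure K, ζ ^ n = 1 → g • ζ = ζ := by
  rw [ContinuousRep.mem_ker]
  constructor
  · intro hg ζ hζ
    have h : ∀ z : DiscreteGaloisModule.MuCarrier K n, DiscreteGaloisModule.mu K n g z = z :=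
      fun z => by rw [hg]; rfl
    let r : rootsOfUnity n (AlgebraicClosure K) := rootsOfUnity.mkOfPowEq ζ hζ
    have hr : ((r : (AlgebraicClosure K)ˣ) : AlgebraicClosure K) = ζ := rfl
    have h1 := congrArg DiscreteGaloisModule.MuCarrier.toAdditive
      (h (DiscreteGaloisModule.MuCarrier.ofRootsOfUnity r))
    rw [DiscreteGaloisModule.mu_apply_apply] at h1
    have h2 : g • r = r := Additive.ofMul.injective h1
    have h3 : (((g • r : rootsOfUnity n (AlgebraicClosure K)) : (AlgebraicClosure K)ˣ) :
        AlgebraicClosure K) = ((r : (AlgebraicClosure K)ˣ) : AlgebraicClosure K) := by rw [h2]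
    rwa [absoluteGaloisGroup.coe_smul_rootsOfUnity, Units.coe_smul, hr] at h3
  · intro h
    refine LinearMap.ext fun z => ?_
    rw [LinearMap.id_apply]
    set u : rootsOfUnity n (AlgebraicClosure K) := (DiscreteGaloisModule.MuCarrier.toAdditive z).toMul
      with hu
    have hu1 : ((u : (AlgebraicClosure K)ˣ) : AlgebraicClosure K) ^ n = 1 := by
      have h' := u.2
      rw [mem_rootsOfUnity] at h'
      rw [← Units.val_pow_eq_pow_val, h', Units.val_one]
    apply DiscreteGaloisModule.MuCarrier.toAdditive.injective
    rw [DiscreteGaloisModule.mu_apply_apply]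
    change Additive.ofMul (g • u) = Additive.ofMul u
    refine congrArg Additive.ofMul (Subtype.ext (Units.ext ?_))
    rw [absoluteGaloisGroup.coe_smul_rootsOfUnity, Units.coe_smul]
    exact h _ hu1

/-- `g ↦ g^τ` preserves the kernel of `μₙ` (`τ` permutes the roots of unity of `K̄`).
[cite: Howard2004HeegnerKolyvagin, Lemma 1.6.2 proof (arXiv p. 11 L36–38: «`L` … the Galois closure (over `ℚ`) of `K(T^{(2k-1)}, μ_{p^{2k-1}})`»)] -/
theorem ConjugationDatum.conj_mem_ker_mu (cd : ConjugationDatum K) {n : ℕ} [NeZero n]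
    {g : absoluteGaloisGroup K} (hg : g ∈ (DiscreteGaloisModule.mu K n).ker) :
    cd.conj g ∈ (DiscreteGaloisModule.mu K n).ker := by
  rw [mem_ker_mu_iff] at hg ⊢
  intro ζ hζ
  have h1 : g • cd.τ ζ = cd.τ ζ := hg _ (by rw [← map_pow, hζ, map_one])
  change cd.τ.symm (g • cd.τ ζ) = ζ
  rw [h1, RingEquiv.symm_apply_apply]

/-- `g ↦ g^τ` preserves `⨅ₘ ker μ_{p^m}` (the group `Γ_{K(μ_{p^∞})}`).
[cite: Howard2004HeegnerKolyvagin, §1.3 H.2 (arXiv p. 7 L61–63)] -/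
theorem ConjugationDatum.conj_mem_iInf_ker_mu (cd : ConjugationDatum K) {p : ℕ} [NeZero p]
    {g : absoluteGaloisGroup K} (hg : g ∈ ⨅ m : ℕ, (DiscreteGaloisModule.mu K (p ^ m)).ker) :
    cd.conj g ∈ ⨅ m : ℕ, (DiscreteGaloisModule.mu K (p ^ m)).ker := by
  rw [Subgroup.mem_iInf] at hg ⊢
  exact fun m => cd.conj_mem_ker_mu (hg m)

/-- **A standard `Λ`.**  For a FINITE discrete `Γ_K`-module `M` (a level `T^{(j)}`, or `T̄`) and
`n ≥ 1` (Howard: `p^{2k-1}`), the subgroup `Λ = ker(M) ⊓ (ker M)^τ ⊓ ker(μₙ)` (Howard's `Γ_L`,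
`L ⊇ K(T^{(2k-1)}, μ_{p^{2k-1}})`) is OPEN, NORMAL, `τ`-STABLE, acts trivially on `M`, fixes the
`n`-th roots of unity (so the Frobenius clause «`(ug)` fixes `μₙ` ⇒ `n ∣ ℓ + 1`» of the Čebotarev
step applies to its elements), and contains `Γ₀ ⊓ Γ₁` for every `τ`-stable `Γ₀` acting trivially
on `M` and every `Γ₁ ≤ ker μₙ` — in particular H.2's `Γ_F ⊓ ⨅ₘ ker μ_{p^m}` when `n = p^s`, so that
the injectivity clause of H.2 feeds `exists_mem_apply_ne_zero_of_resSubgroup_injOn`.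
[cite: Howard2004HeegnerKolyvagin, Lemma 1.6.2 proof (arXiv p. 11 L36–40)] -/
theorem ConjugationDatum.exists_standard_open_subgroup (cd : ConjugationDatum K) [Finite M]
    (ρ : DiscreteGaloisModule K M) (n : ℕ) [NeZero n] :
    ∃ Λ : Subgroup (absoluteGaloisGroup K), IsOpen (Λ : Set (absoluteGaloisGroup K)) ∧ Λ.Normal ∧
      (∀ g ∈ Λ, cd.conj g ∈ Λ) ∧ (∀ g ∈ Λ, ∀ x : M, ρ g x = x) ∧
      (∀ g ∈ Λ, ∀ ζ : AlgebraicClosure K, ζ ^ n = 1 → g • ζ = ζ) ∧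
      ∀ Γ₀ Γ₁ : Subgroup (absoluteGaloisGroup K), (∀ g ∈ Γ₀, cd.conj g ∈ Γ₀) →
        (∀ g ∈ Γ₀, ∀ x : M, ρ g x = x) → Γ₁ ≤ (DiscreteGaloisModule.mu K n).ker → Γ₀ ⊓ Γ₁ ≤ Λ := by
  haveI : Finite (DiscreteGaloisModule.MuCarrier K n) :=
    inferInstanceAs (Finite (Additive (rootsOfUnity n (AlgebraicClosure K))))
  haveI h1 : (ρ.ker).Normal := MonoidHom.normal_ker ρ.toRepresentation
  haveI h2 : ((DiscreteGaloisModule.mu K n).ker).Normal :=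
    MonoidHom.normal_ker (DiscreteGaloisModule.mu K n).toRepresentation
  have hkerρ : ∀ g, g ∈ ρ.ker ↔ ∀ x : M, ρ g x = x := fun g => by
    rw [ContinuousRep.mem_ker, LinearMap.ext_iff]; rfl
  refine ⟨ρ.ker ⊓ (ρ.ker).comap (cd.conj : absoluteGaloisGroup K →* absoluteGaloisGroup K) ⊓
    (DiscreteGaloisModule.mu K n).ker, ?_, ?_, ?_, ?_, ?_, ?_⟩
  · exact ((DiscreteGaloisModule.isOpen_ker_of_finite ρ).inter
      ((DiscreteGaloisModule.isOpen_ker_of_finite ρ).preimage (map_continuous cd.conj))).inter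
      (DiscreteGaloisModule.isOpen_ker_of_finite (DiscreteGaloisModule.mu K n))
  · exact inferInstance
  · rintro g ⟨⟨hg₁, hg₂⟩, hg₃⟩
    refine ⟨⟨hg₂, ?_⟩, cd.conj_mem_ker_mu hg₃⟩
    change cd.conj (cd.conj g) ∈ ρ.ker
    rw [cd.isLift.conjGalCMH_conjGalCMH cd.involutive]
    exact hg₁
  · rintro g ⟨⟨hg₁, -⟩, -⟩
    exact (hkerρ g).mp hg₁
  · rintro g ⟨-, hg₃⟩
    exact (mem_ker_mu_iff g).mp hg₃
  · rintro Γ₀ Γ₁ hΓ₀c hΓ₀t hΓ₁ g ⟨hg₀, hg₁⟩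
    exact ⟨⟨(hkerρ g).mpr (hΓ₀t g hg₀), (hkerρ _).mpr (hΓ₀t _ (hΓ₀c g hg₀))⟩, hΓ₁ hg₁⟩

omit [NumberField K] in
/-- The H.2 instance of the inclusion: `⨅ₘ ker μ_{p^m} ≤ ker μ_{p^s}` (take `Γ₁ = ⨅ₘ ker μ_{p^m}`,
`n = p^s` in `ConjugationDatum.exists_standard_open_subgroup`).
[cite: Howard2004HeegnerKolyvagin, §1.3 H.2 (arXiv p. 7 L61–63)] -/
theorem iInf_ker_mu_le_ker_mu_pow (p s : ℕ) :
    (⨅ m : ℕ, (DiscreteGaloisModule.mu K (p ^ m)).ker) ≤ (DiscreteGaloisModule.mu K (p ^ s)).ker :=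
  iInf_le _ s

end Lambda

/-! ## §7 Values at `σ^τ σ` are `θ`-eigenvectors; three classes at one Frobenius (Lemma 1.6.4, Case i)

In Case i of Lemma 1.6.4 the prime `ℓ` must see THREE classes: `loc_ℓ(d) ≠ 0` for the multiple `d`
of `κ_n` (so that the Kolyvagin relation is contradicted), `loc_ℓ(d⁺) ≠ 0` and `loc_ℓ(c⁻) ≠ 0` (so
that the parity lemma lowers both `ρ(n)^±`).  At a Frobenius `x = σ^τ σ`, `σ ∈ Λ`, the value of a
`(±)`-eigencocycle is a `(±)`-eigenvector of `θ`, so `d(x) = d⁺(x) + d⁻(x) ≠ 0` as soon as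
`d⁺(x) ≠ 0`: the prime produced for the pair `(d⁺, c⁻)` serves `d` as well.
[arXiv p. 12 L3–9: «This `d` has nontrivial projection onto one of the `τ`-eigencomponents …
Assume that `d⁺ ≠ 0`.  By Lemma (Cheb) we may choose a prime `ℓ ∈ 𝓛^{(2k-1)}` at which both `d⁺` and
some element of `H¹_{F(n)}(K,T̄)⁻` have nontrivial localization … the Kolyvagin system relations
imply that `loc_ℓ(κ^{(k)}_n) = 0`, contradicting the choice of `ℓ`.»] -/

namespace ResidualTau

variable {R : Type} [CommRing R] [Module R Nbar] {cd : ConjugationDatum K}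
  {ρbar : DiscreteGaloisModule K Nbar}

/-- `(σ^τ σ)^τ = σ (σ^τ σ) σ⁻¹` for an involutive lift. [cite: Howard2004HeegnerKolyvagin, Lemma 1.6.2 proof (arXiv p. 11 L45–47)] -/
theorem conj_conj_mul_self (cd : ConjugationDatum K) (σ : absoluteGaloisGroup K) :
    cd.conj (cd.conj σ * σ) = σ * (cd.conj σ * σ) * σ⁻¹ := by
  rw [show cd.conj (cd.conj σ * σ) = cd.conj (cd.conj σ) * cd.conj σ from map_mul cd.conj _ _,
    cd.isLift.conjGalCMH_conjGalCMH cd.involutive, ← mul_assoc, mul_inv_cancel_right]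

/-- On `Λ`, a cocycle takes the same value at `σ^τ σ` and at its `τ`-conjugate:
`φ((σ^τ σ)^τ) = φ(σ^τ σ)` (`σ ∈ Λ`, `Λ` `τ`-stable acting trivially).
[cite: Howard2004HeegnerKolyvagin, Lemma 1.6.2 proof (arXiv p. 11 L45–50)] -/
theorem apply_conj_conj_mul_self {Λ : Subgroup (absoluteGaloisGroup K)}
    (hΛc : ∀ g ∈ Λ, cd.conj g ∈ Λ) (hΛt : ∀ g ∈ Λ, ∀ x : Nbar, ρbar g x = x)
    (φ : contOneCocycles ρbar.toTopRep) {σ : absoluteGaloisGroup K} (hσ : σ ∈ Λ) :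
    φ.1 (cd.conj (cd.conj σ * σ)) = φ.1 (cd.conj σ * σ) := by
  rw [conj_conj_mul_self cd σ,
    contOneCocycles.apply_conj_of_apply_eq ρbar φ (hΛt _ (Λ.mul_mem (hΛc σ hσ) hσ)) σ, hΛt σ hσ]

/-- **The value of a `(+)`-eigencocycle at `σ^τ σ` is `θ`-fixed** (`σ ∈ Λ`): `θ(φ⁺(σ^τσ)) = φ⁺(σ^τσ)`,
i.e. `c⁺(η) ∈ T̄⁺` for `η ∈ G⁺`. [cite: Howard2004HeegnerKolyvagin, Lemma 1.6.2 proof (arXiv p. 11 L41–45: «`c⁺ : G⁺ → T̄⁺`»)] -/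
theorem theta_apply_conj_mul_self_of_theta_eq {Λ : Subgroup (absoluteGaloisGroup K)}
    (hΛc : ∀ g ∈ Λ, cd.conj g ∈ Λ) (hΛt : ∀ g ∈ Λ, ∀ x : Nbar, ρbar g x = x)
    (A : ResidualTau (R := R) cd ρbar) (φ : contOneCocycles ρbar.toTopRep)
    (hφ : ∀ g ∈ Λ, φ.1 (cd.conj g) = A.θ (φ.1 g)) {σ : absoluteGaloisGroup K} (hσ : σ ∈ Λ) :
    A.θ (φ.1 (cd.conj σ * σ)) = φ.1 (cd.conj σ * σ) := by
  rw [← hφ _ (Λ.mul_mem (hΛc σ hσ) hσ), apply_conj_conj_mul_self hΛc hΛt φ hσ]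

/-- **The value of a `(-)`-eigencocycle at `σ^τ σ` is `θ`-anti-fixed** (`σ ∈ Λ`):
`θ(φ⁻(σ^τσ)) = -φ⁻(σ^τσ)`, i.e. `c⁻(η) ∈ T̄⁻` for `η ∈ G⁺`.
[cite: Howard2004HeegnerKolyvagin, Lemma 1.6.2 proof (arXiv p. 11 L41–45: «`c⁻ : G⁺ → T̄⁻`»)] -/
theorem theta_apply_conj_mul_self_of_theta_eq_neg {Λ : Subgroup (absoluteGaloisGroup K)}
    (hΛc : ∀ g ∈ Λ, cd.conj g ∈ Λ) (hΛt : ∀ g ∈ Λ, ∀ x : Nbar, ρbar g x = x)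
    (A : ResidualTau (R := R) cd ρbar) (φ : contOneCocycles ρbar.toTopRep)
    (hφ : ∀ g ∈ Λ, φ.1 (cd.conj g) = -A.θ (φ.1 g)) {σ : absoluteGaloisGroup K} (hσ : σ ∈ Λ) :
    A.θ (φ.1 (cd.conj σ * σ)) = -φ.1 (cd.conj σ * σ) := by
  have h := hφ _ (Λ.mul_mem (hΛc σ hσ) hσ)
  rw [apply_conj_conj_mul_self hΛc hΛt φ hσ] at h
  have h' := congrArg Neg.neg h
  rw [neg_neg] at h'
  exact h'.symm

/-- **Eigencomponents do not cancel at `σ^τ σ`**: if `φ⁺(σ^τσ) + φ⁻(σ^τσ) = 0` for a `(+)`- and a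
`(-)`-eigencocycle then both values vanish (`2 ∈ R×`).
[cite: Howard2004HeegnerKolyvagin, Lemma 1.6.4 proof, Case i (arXiv p. 12 L3–9)] -/
theorem apply_conj_mul_self_eq_zero_of_add_eq_zero (A : ResidualTau (R := R) cd ρbar)
    (htwo : IsUnit (2 : R)) {Λ : Subgroup (absoluteGaloisGroup K)}
    (hΛc : ∀ g ∈ Λ, cd.conj g ∈ Λ) (hΛt : ∀ g ∈ Λ, ∀ x : Nbar, ρbar g x = x)
    (φp φm : contOneCocycles ρbar.toTopRep)
    (hφp : ∀ g ∈ Λ, φp.1 (cd.conj g) = A.θ (φp.1 g))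
    (hφm : ∀ g ∈ Λ, φm.1 (cd.conj g) = -A.θ (φm.1 g)) {σ : absoluteGaloisGroup K} (hσ : σ ∈ Λ)
    (h : φp.1 (cd.conj σ * σ) + φm.1 (cd.conj σ * σ) = 0) :
    φp.1 (cd.conj σ * σ) = 0 ∧ φm.1 (cd.conj σ * σ) = 0 := by
  have h2 := congrArg A.θ h
  rw [map_add, theta_apply_conj_mul_self_of_theta_eq hΛc hΛt A φp hφp hσ,
    theta_apply_conj_mul_self_of_theta_eq_neg hΛc hΛt A φm hφm hσ, map_zero] at h2
  have h3 : φp.1 (cd.conj σ * σ) + φp.1 (cd.conj σ * σ) = 0 := by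
    rw [show φp.1 (cd.conj σ * σ) + φp.1 (cd.conj σ * σ) =
      (φp.1 (cd.conj σ * σ) + φm.1 (cd.conj σ * σ)) +
        (φp.1 (cd.conj σ * σ) + -φm.1 (cd.conj σ * σ)) by abel, h, h2, add_zero]
  rw [← two_smul R] at h3
  obtain ⟨u, hu⟩ := htwo
  have h4 : u • φp.1 (cd.conj σ * σ) = 0 := by rw [Units.smul_def, hu]; exact h3
  have hp : φp.1 (cd.conj σ * σ) = 0 := by rw [← inv_smul_smul u (φp.1 (cd.conj σ * σ)), h4, smul_zero]
  refine ⟨hp, ?_⟩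
  rwa [hp, zero_add] at h

/-- Hence `(φ⁺ + φ⁻)(σ^τσ) ≠ 0` as soon as one eigencomponent is non-zero there.
[cite: Howard2004HeegnerKolyvagin, Lemma 1.6.4 proof, Case i (arXiv p. 12 L3–9)] -/
theorem apply_add_apply_conj_mul_self_ne_zero (A : ResidualTau (R := R) cd ρbar)
    (htwo : IsUnit (2 : R)) {Λ : Subgroup (absoluteGaloisGroup K)}
    (hΛc : ∀ g ∈ Λ, cd.conj g ∈ Λ) (hΛt : ∀ g ∈ Λ, ∀ x : Nbar, ρbar g x = x)
    (φp φm : contOneCocycles ρbar.toTopRep)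
    (hφp : ∀ g ∈ Λ, φp.1 (cd.conj g) = A.θ (φp.1 g))
    (hφm : ∀ g ∈ Λ, φm.1 (cd.conj g) = -A.θ (φm.1 g)) {σ : absoluteGaloisGroup K} (hσ : σ ∈ Λ)
    (hne : φp.1 (cd.conj σ * σ) ≠ 0 ∨ φm.1 (cd.conj σ * σ) ≠ 0) :
    φp.1 (cd.conj σ * σ) + φm.1 (cd.conj σ * σ) ≠ 0 := by
  intro h
  have h' := apply_conj_mul_self_eq_zero_of_add_eq_zero A htwo hΛc hΛt φp φm hφp hφm hσ h
  rcases hne with hne | hne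
  · exact hne h'.1
  · exact hne h'.2

/-- **Three classes at one Frobenius, `d⁺ ≠ 0`** (Lemma 1.6.4, Case i): for a cocycle `d` split as
`d = d⁺ + d⁻` into eigencocycles on `Λ` with `d⁺|_Λ ≠ 0`, and a `(-)`-eigencocycle `c⁻` with
`c⁻|_Λ ≠ 0`, there are an inert prime `ℓ ∉ B` (place `w ∉ S`) and a Frobenius `x = g^τ g ∈ Λ` above
it with `d(x) ≠ 0`, `d⁺(x) ≠ 0`, `c⁻(x) ≠ 0` (and the root-of-unity clauses).
[cite: Howard2004HeegnerKolyvagin, Lemma 1.6.4 proof, Case i (arXiv p. 12 L3–9) with Lemma 1.6.2] -/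
theorem exists_inert_prime_isArithFrobAt_three_apply_ne_zero
    (hC : Automorphic.chebotarev_artinRep) (hK : IsImaginaryQuadratic K)
    (A : ResidualTau (R := R) cd ρbar) (hlin : ρbar.IsScalarLinear R)
    (hirr : ∀ W : Submodule R Nbar,
      (∀ (σ : absoluteGaloisGroup K) (x : Nbar), x ∈ W → ρbar σ x ∈ W) → W = ⊥ ∨ W = ⊤)
    (h5a : H5a A) (htwo : IsUnit (2 : R))
    {Λ : Subgroup (absoluteGaloisGroup K)} (hΛo : IsOpen (Λ : Set (absoluteGaloisGroup K)))
    (hΛn : Λ.Normal) (hΛc : ∀ g ∈ Λ, cd.conj g ∈ Λ) (hΛt : ∀ g ∈ Λ, ∀ x : Nbar, ρbar g x = x)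
    (d dp dm cm : contOneCocycles ρbar.toTopRep) (hdec : ∀ g, d.1 g = dp.1 g + dm.1 g)
    (hdp : ∀ g ∈ Λ, dp.1 (cd.conj g) = A.θ (dp.1 g))
    (hdm : ∀ g ∈ Λ, dm.1 (cd.conj g) = -A.θ (dm.1 g))
    (hcm : ∀ g ∈ Λ, cm.1 (cd.conj g) = -A.θ (cm.1 g))
    (hnedp : ∃ g ∈ Λ, dp.1 g ≠ 0) (hnecm : ∃ g ∈ Λ, cm.1 g ≠ 0)
    (B : Finset ℕ) {S : Set (HeightOneSpectrum (𝓞 K))} (hS : S.Finite) :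
    ∃ ℓ : ℕ, ℓ.Prime ∧ ℓ ∉ B ∧ (Ideal.span {(ℓ : 𝓞 K)}).IsPrime ∧
      ∃ w : HeightOneSpectrum (𝓞 K), w ∉ S ∧ (ℓ : 𝓞 K) ∈ w.asIdeal ∧
        (∀ w' : HeightOneSpectrum (𝓞 K), (ℓ : 𝓞 K) ∈ w'.asIdeal → w' = w) ∧
        ∃ g ∈ Λ, cd.conj g * g ∈ Λ ∧
          (∃ 𝔔 ∈ w.primesAbove, IsArithFrobAt (𝓞 K) (cd.conj g * g) 𝔔) ∧
          d.1 (cd.conj g * g) ≠ 0 ∧ dp.1 (cd.conj g * g) ≠ 0 ∧ cm.1 (cd.conj g * g) ≠ 0 ∧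
          (∀ (m : ℕ) (ζ : AlgebraicClosure K), ¬ ℓ ∣ m → ζ ^ m = 1 → cd.τ (g • ζ) = ζ ^ ℓ) ∧
          ∀ m : ℕ, ¬ ℓ ∣ m → (∀ ζ : AlgebraicClosure K, ζ ^ m = 1 → g • ζ = ζ) → m ∣ ℓ + 1 := by
  obtain ⟨ℓ, hℓ, hℓB, hℓP, w, hwS, hℓw, hwu, g, hg, hxg, hfrob, hp, hm, hζ, hdiv⟩ :=
    exists_inert_prime_isArithFrobAt_apply_ne_zero hC hK A hlin hirr h5a htwo hΛo hΛn hΛc hΛt dp cm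
      hdp hcm hnedp hnecm B hS
  refine ⟨ℓ, hℓ, hℓB, hℓP, w, hwS, hℓw, hwu, g, hg, hxg, hfrob, ?_, hp, hm, hζ, hdiv⟩
  rw [hdec]
  exact apply_add_apply_conj_mul_self_ne_zero A htwo hΛc hΛt dp dm hdp hdm hg (Or.inl hp)

/-- **Three classes at one Frobenius, `d⁻ ≠ 0`** (Lemma 1.6.4, Case i, the symmetric sub-case): as
above with `d⁻|_Λ ≠ 0` and a `(+)`-eigencocycle `c⁺` with `c⁺|_Λ ≠ 0`: a Frobenius `x = g^τ g ∈ Λ`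
with `d(x) ≠ 0`, `c⁺(x) ≠ 0`, `d⁻(x) ≠ 0`.
[cite: Howard2004HeegnerKolyvagin, Lemma 1.6.4 proof, Case i (arXiv p. 12 L3–9) with Lemma 1.6.2] -/
theorem exists_inert_prime_isArithFrobAt_three_apply_ne_zero'
    (hC : Automorphic.chebotarev_artinRep) (hK : IsImaginaryQuadratic K)
    (A : ResidualTau (R := R) cd ρbar) (hlin : ρbar.IsScalarLinear R)
    (hirr : ∀ W : Submodule R Nbar,
      (∀ (σ : absoluteGaloisGroup K) (x : Nbar), x ∈ W → ρbar σ x ∈ W) → W = ⊥ ∨ W = ⊤)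
    (h5a : H5a A) (htwo : IsUnit (2 : R))
    {Λ : Subgroup (absoluteGaloisGroup K)} (hΛo : IsOpen (Λ : Set (absoluteGaloisGroup K)))
    (hΛn : Λ.Normal) (hΛc : ∀ g ∈ Λ, cd.conj g ∈ Λ) (hΛt : ∀ g ∈ Λ, ∀ x : Nbar, ρbar g x = x)
    (d dp dm cp : contOneCocycles ρbar.toTopRep) (hdec : ∀ g, d.1 g = dp.1 g + dm.1 g)
    (hdp : ∀ g ∈ Λ, dp.1 (cd.conj g) = A.θ (dp.1 g))
    (hdm : ∀ g ∈ Λ, dm.1 (cd.conj g) = -A.θ (dm.1 g))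
    (hcp : ∀ g ∈ Λ, cp.1 (cd.conj g) = A.θ (cp.1 g))
    (hnedm : ∃ g ∈ Λ, dm.1 g ≠ 0) (hnecp : ∃ g ∈ Λ, cp.1 g ≠ 0)
    (B : Finset ℕ) {S : Set (HeightOneSpectrum (𝓞 K))} (hS : S.Finite) :
    ∃ ℓ : ℕ, ℓ.Prime ∧ ℓ ∉ B ∧ (Ideal.span {(ℓ : 𝓞 K)}).IsPrime ∧
      ∃ w : HeightOneSpectrum (𝓞 K), w ∉ S ∧ (ℓ : 𝓞 K) ∈ w.asIdeal ∧
        (∀ w' : HeightOneSpectrum (𝓞 K), (ℓ : 𝓞 K) ∈ w'.asIdeal → w' = w) ∧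
        ∃ g ∈ Λ, cd.conj g * g ∈ Λ ∧
          (∃ 𝔔 ∈ w.primesAbove, IsArithFrobAt (𝓞 K) (cd.conj g * g) 𝔔) ∧
          d.1 (cd.conj g * g) ≠ 0 ∧ cp.1 (cd.conj g * g) ≠ 0 ∧ dm.1 (cd.conj g * g) ≠ 0 ∧
          (∀ (m : ℕ) (ζ : AlgebraicClosure K), ¬ ℓ ∣ m → ζ ^ m = 1 → cd.τ (g • ζ) = ζ ^ ℓ) ∧
          ∀ m : ℕ, ¬ ℓ ∣ m → (∀ ζ : AlgebraicClosure K, ζ ^ m = 1 → g • ζ = ζ) → m ∣ ℓ + 1 := by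
  obtain ⟨ℓ, hℓ, hℓB, hℓP, w, hwS, hℓw, hwu, g, hg, hxg, hfrob, hp, hm, hζ, hdiv⟩ :=
    exists_inert_prime_isArithFrobAt_apply_ne_zero hC hK A hlin hirr h5a htwo hΛo hΛn hΛc hΛt cp dm
      hcp hdm hnecp hnedm B hS
  refine ⟨ℓ, hℓ, hℓB, hℓP, w, hwS, hℓw, hwu, g, hg, hxg, hfrob, ?_, hp, hm, hζ, hdiv⟩
  rw [hdec]
  exact apply_add_apply_conj_mul_self_ne_zero A htwo hΛc hΛt dp dm hdp hdm hg (Or.inr hm)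

end ResidualTau

end Literature.NumberTheory.GaloisCohomology.Howard2004

end
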